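import Summits.BirchSwinnertonDyer.BirchSwinnertonDyer.Theorems.Rank1ResidualJetCarrierNeShaKernel
import Summits.BirchSwinnertonDyer.BirchSwinnertonDyer.Theorems.Rank1ResidualJetCarrierAdd
import Literature.NumberTheory.EllipticCurves.Rank1Residual.MultiplicativeThreeTowerProofs
import Literature.NumberTheory.EllipticCurves.HeegnerPointsOfConductorOneRationalityProofs
import Literature.NumberTheory.EllipticCurves.HeegnerPointsOfConductorOneGaloisConjProofs
import Literature.NumberTheory.EllipticCurves.CuspFormLFunctionLevelConductorProofs
import HarnessLib

/-!
# T1 JET (cell `bsd-jet`), road K — the register-ROW-shaped class-free consumers (Heegner datum of any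
# stated level `N`) ⟸ NAMED PRINT ONLY: reading binder `hJ` fed by road K, structure fact `hMcU` replaced
# by the divided descent, `hrec` ∕ `hD36` supplied by Literature theorems, `hlev` reduced to modularity

HONEST FRAMING (programme file `BSD-LIT2PART-PROGRAMME-v1.md` §HONESTY, verbatim): «no tranche here
proves BSD; ARM L moves the LITERAL column of an r ≤ 1 census into the kernel-proved-modulo-named-print
column; ARM P changes what «named print» is worth.» THEOREMS ONLY (seat `bsd-jet-pv-1`, session g9;
`--supports stmt-BirchSwinnertonDyer-14418`, helper); nothing is booked by this file; 0 classes move.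
Per curve ∕ per pair; not a class theorem; whether a row books is referee A's word.

WHAT. The row-shaped doors `JET.bsdp_of_carrierNeCertificate_level[_of_five_le|_of_mult]` (pv-1 g0,
`Rank1ResidualJetCarrierNeRows`), `JET.bsdp_of_carrierMultCertificate_level_of_surj` and
`JET.bsdp_of_carrierAddCertificate_level[_three_of_frobenius]` (pv-2) — the bodies one step under the
record kits `JET.bsdp_of_jetRow*` — re-issued with EVERY displayed binder a named published statement or
a tree theorem: `hJ` (K1 ∕ K3 ∕ K4 reading) := road K's END FORMS `jetchevDivisibilityCarrier*_of_literatureNoCV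
h52 hPT hF1 h372`; `hMcU` (Kolyvagin–McCallum Cor. 5.6) := the divided descent
(`Rank1ResidualJetCarrierNeShaKernel`, this seat g9); `hrec` ∕ `hD36` := the Literature theorems
`heegnerPointOfConductor_one_galoisConj_holds` ∕ `phi_heegnerTau_mem_singularModuliField_holds`; `hlev`
(Carayol) := `IsNewformOf.level_eq_conductorNorm_of_exists_isNewformOf'` from the modularity binder
`hmod : exists_isNewformOf` (as in ty's `CarrierReadingRecordsKitFed`). DISPLAYED NAMED PRINT of a JET
row after this file: {`h52` [McC] Prop. 5.2, `hPT` Poitou–Tate for Selmer structures (∀ K), `hF1`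
[GZ86 III (3.1)], `h372` Gross Prop. 3.7 (2), `hGZK` GZK, `hKo` Kolyvagin, `hmod` modularity} — seven
published statements; no reading binder, no structure-theorem fact, no conductor-`1` binders.
References: [cite: Jetchev2008, Thm. 1.4, Cor. 1.5 (p. 812)] [cite: McCallumLMS1991, Prop. 5.2, Cor. 5.6]
[cite: GrossLMS1991, Prop. 3.7, §10] [cite: DiamondShurman2005, Thm. 8.8.1] [cite: Darmon2004, Thm. 3.6,
3.7] [cite: SerreAbelianLadic1968, IV-23 Lemma 3] [cite: Wuthrich2014, Lemma 20]. Design: no definitions;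
`K : Type`. Axioms: `propext`, `Classical.choice`, `Quot.sound`.
-/

set_option autoImplicit false

noncomputable section

open scoped Classical

open WeierstrassCurve Literature.NumberTheory.EllipticCurves
  Literature.NumberTheory.EllipticCurves.ModularForms Literature.NumberTheory.GaloisCohomology
  Literature.NumberTheory.EllipticCurves.Rank1Residual
  Summit.BirchSwinnertonDyer.Rank1Residual Summit.BirchSwinnertonDyer.Rank1Residual.X11b

namespace Summit.BirchSwinnertonDyer.Rank1Residual.JET

/-! ### §1 Bucket A (`q ≠ p`) at a Heegner datum of level `N` -/

/-- **`BSD(E,p)` from the bucket-A certificate at a Heegner datum of any stated level `N` ⟸ NAMED PRINT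
ONLY** (`p` odd, `p`-adic tower onto): `bsdp_of_carrierNeCertificate_level` with `hJ`, `hMcU`, `hrec`,
`hD36`, `hlev` all fed (module docstring). Displayed: {`h52`, `hPT` ∀K, `hF1`, `h372`, `hGZK`, `hKo`, `hmod`}.
[cite: Jetchev2008, Cor. 1.5 (p. 812)] [cite: DiamondShurman2005, Thm. 8.8.1] [cite: McCallumLMS1991, Cor. 5.6] -/
theorem bsdp_of_carrierNeCertificate_level_of_literature
    (h52 : McCallum1991.prop52_exists_conductor_kolyvaginClass_order_eq)
    (hPT : ∀ (K : Type) [Field K] [NumberField K], poitouTate_selmerStructure_duality_conj K)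
    (hF1 : Gross1991_heegnerPoint_sub_ratTorsion_mem_E0)
    (h372 : GrossLMS1991.prop37_2_frobeniusCongruence)
    (hGZK : rank_eq_analyticRank_of_analyticRank_le_one)
    (hKo : ∀ (N : ℕ) [NeZero N] (W : WeierstrassCurve ℚ) (K : Type) [Field K] [NumberField K],
      kolyvagin N W K)
    (hmod : exists_isNewformOf)
    (W : WeierstrassCurve ℚ) [W.IsElliptic] [W.IsGloballyMinimal] (p : ℕ) [Fact p.Prime]
    {N : ℕ} [NeZero N] {K : Type} [Field K] [NumberField K] (hK : IsImaginaryQuadratic K)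
    (hD3 : NumberField.discr K ≠ -3) (hD4 : NumberField.discr K ≠ -4)
    (hH : SatisfiesHeegnerHypothesis N K) {P : (W.baseChange K).toAffine.Point}
    (hP : IsHeegnerPoint N W K P) (hnt : ¬ IsOfFinAddOrder P)
    (hp2 : p ≠ 2) (htower : ∀ n : ℕ, W.HasSurjectiveModNGaloisRep (p ^ n : ℕ))
    (q : ℕ) [Fact q.Prime] (hqN : q ∣ N) (hqp : q ≠ p)
    (hI : padicValNat p (AddSubgroup.zmultiples P).index ≤
      padicValNat p ((W.baseChange ℚ_[q]).localTamagawaNumber ℤ_[q]))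
    (hr : W.analyticRank ≤ 1) {s : ℚ} (hs : shaAn W = (s : ℂ)) (hv : padicValRat p s = 0) :
    BSDp W p := by
  obtain ⟨Dt, -, -, -⟩ := id hP
  have hN : N = W.conductorNorm ℤ := IsNewformOf.level_eq_conductorNorm_of_exists_isNewformOf' hmod Dt.isNewformOf
  subst hN
  exact bsdp_of_carrierNeCertificate_of_literature h52 hPT hF1 h372 hGZK W K (hKo _ W K)
    (heegnerPointOfConductor_one_galoisConj_holds _ W K) (phi_heegnerTau_mem_singularModuliField_holds _ W K)
    hK hD3 hD4 hH p hp2 htower hP hnt q hqN hqp hI hr hs hv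

/-- **The same at `p ≥ 5` with the register's galrep datum `ρ̄_{E,p}` onto** (tower by Serre).
Displayed: {`h52`, `hPT` ∀K, `hF1`, `h372`, `hGZK`, `hKo`, `hmod`}. [cite: Jetchev2008, Cor. 1.5 (p. 812)]
[cite: SerreAbelianLadic1968, Ch. IV §3.4 Lemma 3 (IV-23)] [cite: DiamondShurman2005, Thm. 8.8.1] -/
theorem bsdp_of_carrierNeCertificate_level_of_five_le_of_literature
    (h52 : McCallum1991.prop52_exists_conductor_kolyvaginClass_order_eq)
    (hPT : ∀ (K : Type) [Field K] [NumberField K], poitouTate_selmerStructure_duality_conj K)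
    (hF1 : Gross1991_heegnerPoint_sub_ratTorsion_mem_E0)
    (h372 : GrossLMS1991.prop37_2_frobeniusCongruence)
    (hGZK : rank_eq_analyticRank_of_analyticRank_le_one)
    (hKo : ∀ (N : ℕ) [NeZero N] (W : WeierstrassCurve ℚ) (K : Type) [Field K] [NumberField K],
      kolyvagin N W K)
    (hmod : exists_isNewformOf)
    (W : WeierstrassCurve ℚ) [W.IsElliptic] [W.IsGloballyMinimal] (p : ℕ) [Fact p.Prime]
    {N : ℕ} [NeZero N] {K : Type} [Field K] [NumberField K] (hK : IsImaginaryQuadratic K)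
    (hD3 : NumberField.discr K ≠ -3) (hD4 : NumberField.discr K ≠ -4)
    (hH : SatisfiesHeegnerHypothesis N K) {P : (W.baseChange K).toAffine.Point}
    (hP : IsHeegnerPoint N W K P) (hnt : ¬ IsOfFinAddOrder P)
    (h5 : 5 ≤ p) (hsurj : W.HasSurjectiveModNGaloisRep p)
    (q : ℕ) [Fact q.Prime] (hqN : q ∣ N) (hqp : q ≠ p)
    (hI : padicValNat p (AddSubgroup.zmultiples P).index ≤
      padicValNat p ((W.baseChange ℚ_[q]).localTamagawaNumber ℤ_[q]))
    (hr : W.analyticRank ≤ 1) {s : ℚ} (hs : shaAn W = (s : ℂ)) (hv : padicValRat p s = 0) :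
    BSDp W p :=
  bsdp_of_carrierNeCertificate_level_of_literature h52 hPT hF1 h372 hGZK hKo hmod W p hK hD3 hD4 hH hP hnt
    (by omega) (serre_hasSurjectiveModNGaloisRep_pow_holds W p h5 hsurj) q hqN hqp hI hr hs hv

/-- **The same at a MULTIPLICATIVE odd `p` (the `p ∥ N` rows of bucket A, incl. `p = 3`) with `ρ̄_{E,p}`
onto**: the tower by the Tate line (`forall_hasSurjectiveModNGaloisRep_pow_of_multiplicative_of_surj`).
Displayed: {`h52`, `hPT` ∀K, `hF1`, `h372`, `hGZK`, `hKo`, `hmod`}. [cite: Jetchev2008, Cor. 1.5 (p. 812)]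
[cite: Wuthrich2014, Lemma 20 (p. 399)] [cite: DiamondShurman2005, Thm. 8.8.1] -/
theorem bsdp_of_carrierNeCertificate_level_of_mult_of_literature
    (h52 : McCallum1991.prop52_exists_conductor_kolyvaginClass_order_eq)
    (hPT : ∀ (K : Type) [Field K] [NumberField K], poitouTate_selmerStructure_duality_conj K)
    (hF1 : Gross1991_heegnerPoint_sub_ratTorsion_mem_E0)
    (h372 : GrossLMS1991.prop37_2_frobeniusCongruence)
    (hGZK : rank_eq_analyticRank_of_analyticRank_le_one)
    (hKo : ∀ (N : ℕ) [NeZero N] (W : WeierstrassCurve ℚ) (K : Type) [Field K] [NumberField K],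
      kolyvagin N W K)
    (hmod : exists_isNewformOf)
    (W : WeierstrassCurve ℚ) [W.IsElliptic] [W.IsGloballyMinimal] (p : ℕ) [Fact p.Prime]
    {N : ℕ} [NeZero N] {K : Type} [Field K] [NumberField K] (hK : IsImaginaryQuadratic K)
    (hD3 : NumberField.discr K ≠ -3) (hD4 : NumberField.discr K ≠ -4)
    (hH : SatisfiesHeegnerHypothesis N K) {P : (W.baseChange K).toAffine.Point}
    (hP : IsHeegnerPoint N W K P) (hnt : ¬ IsOfFinAddOrder P)
    (hp2 : p ≠ 2) (hmult : W.HasMultiplicativeReductionAtPrime p)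
    (hsurj : W.HasSurjectiveModNGaloisRep p)
    (q : ℕ) [Fact q.Prime] (hqN : q ∣ N) (hqp : q ≠ p)
    (hI : padicValNat p (AddSubgroup.zmultiples P).index ≤
      padicValNat p ((W.baseChange ℚ_[q]).localTamagawaNumber ℤ_[q]))
    (hr : W.analyticRank ≤ 1) {s : ℚ} (hs : shaAn W = (s : ℂ)) (hv : padicValRat p s = 0) :
    BSDp W p :=
  bsdp_of_carrierNeCertificate_level_of_literature h52 hPT hF1 h372 hGZK hKo hmod W p hK hD3 hD4 hH hP hnt hp2
    (W.forall_hasSurjectiveModNGaloisRep_pow_of_multiplicative_of_surj p hp2 hmult hsurj) q hqN hqp hI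
    hr hs hv

/-! ### §2 Bucket B (carrier `p` multiplicative) at a Heegner datum of level `N` -/

/-- **`BSD(E,p)` from the bucket-B certificate (`p` odd multiplicative, `ord_p [E(K):ℤP] ≤ ord_p c_p`,
`ρ̄_{E,p}` onto) at a Heegner datum of level `N` ⟸ NAMED PRINT ONLY**: pv-2's
`bsdp_of_carrierMultCertificate_level_of_surj` with `hJ`, `hMcU`, `hrec`, `hD36`, `hlev` all fed.
Displayed: {`h52`, `hPT` ∀K, `hF1`, `h372`, `hGZK`, `hKo`, `hmod`}. [cite: Jetchev2008, Cor. 1.5 (p. 812)]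
[cite: Wuthrich2014, Lemma 20 (p. 399)] [cite: DiamondShurman2005, Thm. 8.8.1] -/
theorem bsdp_of_carrierMultCertificate_level_of_surj_of_literature
    (h52 : McCallum1991.prop52_exists_conductor_kolyvaginClass_order_eq)
    (hPT : ∀ (K : Type) [Field K] [NumberField K], poitouTate_selmerStructure_duality_conj K)
    (hF1 : Gross1991_heegnerPoint_sub_ratTorsion_mem_E0)
    (h372 : GrossLMS1991.prop37_2_frobeniusCongruence)
    (hGZK : rank_eq_analyticRank_of_analyticRank_le_one)
    (hKo : ∀ (N : ℕ) [NeZero N] (W : WeierstrassCurve ℚ) (K : Type) [Field K] [NumberField K],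
      kolyvagin N W K)
    (hmod : exists_isNewformOf)
    (W : WeierstrassCurve ℚ) [W.IsElliptic] [W.IsGloballyMinimal] (p : ℕ) [Fact p.Prime]
    {N : ℕ} [NeZero N] {K : Type} [Field K] [NumberField K] (hK : IsImaginaryQuadratic K)
    (hD3 : NumberField.discr K ≠ -3) (hD4 : NumberField.discr K ≠ -4)
    (hH : SatisfiesHeegnerHypothesis N K) {P : (W.baseChange K).toAffine.Point}
    (hP : IsHeegnerPoint N W K P) (hnt : ¬ IsOfFinAddOrder P)
    (hp2 : p ≠ 2) (hmult : W.HasMultiplicativeReductionAtPrime p)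
    (hsurj : W.HasSurjectiveModNGaloisRep p)
    (hI : padicValNat p (AddSubgroup.zmultiples P).index ≤
      padicValNat p ((W.baseChange ℚ_[p]).localTamagawaNumber ℤ_[p]))
    (hr : W.analyticRank ≤ 1) {s : ℚ} (hs : shaAn W = (s : ℂ)) (hv : padicValRat p s = 0) :
    BSDp W p := by
  obtain ⟨Dt, -, -, -⟩ := id hP
  have hN : N = W.conductorNorm ℤ := IsNewformOf.level_eq_conductorNorm_of_exists_isNewformOf' hmod Dt.isNewformOf
  subst hN
  exact bsdp_of_carrierMultCertificate_of_surj_of_literature h52 hPT hF1 h372 hGZK W K (hKo _ W K)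
    (heegnerPointOfConductor_one_galoisConj_holds _ W K) (phi_heegnerTau_mem_singularModuliField_holds _ W K)
    hK hD3 hD4 hH p hp2 hmult hsurj hP hnt hI hr hs hv

/-! ### §3 Carrier `p` additive at a Heegner datum of level `N` -/

/-- **`BSD(E,p)` from the additive-carrier certificate (`p` odd additive, `ord_p [E(K):ℤP] ≤ ord_p c_p`,
`p`-adic tower onto) at a Heegner datum of level `N` ⟸ NAMED PRINT ONLY**: pv-2's
`bsdp_of_carrierAddCertificate_level` with `hJ`, `hMcU`, `hrec`, `hD36`, `hlev` all fed.
Displayed: {`h52`, `hPT` ∀K, `hF1`, `h372`, `hGZK`, `hKo`, `hmod`}. [cite: Jetchev2008, Cor. 1.5 (p. 812)]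
[cite: DiamondShurman2005, Thm. 8.8.1] [cite: McCallumLMS1991, Cor. 5.6] -/
theorem bsdp_of_carrierAddCertificate_level_of_literature
    (h52 : McCallum1991.prop52_exists_conductor_kolyvaginClass_order_eq)
    (hPT : ∀ (K : Type) [Field K] [NumberField K], poitouTate_selmerStructure_duality_conj K)
    (hF1 : Gross1991_heegnerPoint_sub_ratTorsion_mem_E0)
    (h372 : GrossLMS1991.prop37_2_frobeniusCongruence)
    (hGZK : rank_eq_analyticRank_of_analyticRank_le_one)
    (hKo : ∀ (N : ℕ) [NeZero N] (W : WeierstrassCurve ℚ) (K : Type) [Field K] [NumberField K],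
      kolyvagin N W K)
    (hmod : exists_isNewformOf)
    (W : WeierstrassCurve ℚ) [W.IsElliptic] [W.IsGloballyMinimal] (p : ℕ) [Fact p.Prime]
    {N : ℕ} [NeZero N] {K : Type} [Field K] [NumberField K] (hK : IsImaginaryQuadratic K)
    (hD3 : NumberField.discr K ≠ -3) (hD4 : NumberField.discr K ≠ -4)
    (hH : SatisfiesHeegnerHypothesis N K) {P : (W.baseChange K).toAffine.Point}
    (hP : IsHeegnerPoint N W K P) (hnt : ¬ IsOfFinAddOrder P)
    (hp2 : p ≠ 2) (hng : ¬ W.HasGoodReductionAtPrime p) (hnm : ¬ W.HasMultiplicativeReductionAtPrime p)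
    (htower : ∀ n : ℕ, W.HasSurjectiveModNGaloisRep (p ^ n : ℕ))
    (hI : padicValNat p (AddSubgroup.zmultiples P).index ≤
      padicValNat p ((W.baseChange ℚ_[p]).localTamagawaNumber ℤ_[p]))
    (hr : W.analyticRank ≤ 1) {s : ℚ} (hs : shaAn W = (s : ℂ)) (hv : padicValRat p s = 0) :
    BSDp W p := by
  obtain ⟨Dt, -, -, -⟩ := id hP
  have hN : N = W.conductorNorm ℤ := IsNewformOf.level_eq_conductorNorm_of_exists_isNewformOf' hmod Dt.isNewformOf
  subst hN
  exact bsdp_of_carrierAddCertificate_of_literature h52 hPT hF1 h372 hGZK W K (hKo _ W K)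
    (heegnerPointOfConductor_one_galoisConj_holds _ W K) (phi_heegnerTau_mem_singularModuliField_holds _ W K)
    hK hD3 hD4 hH p hp2 hng hnm htower hP hnt hI hr hs hv

/-- **`BSD(E,3)` from the additive-carrier certificate at `p = 3` (Kodaira IV ∕ IV*, `c₃ = 3`) with the
`3`-adic tower DISCHARGED by ONE Frobenius witness modulo `9`** (`forall_hasSurjectiveModNGaloisRep_three_pow_of_frobenius`)
⟸ NAMED PRINT ONLY: pv-2's `bsdp_of_carrierAddCertificate_level_three_of_frobenius` with every binder fed.
Displayed: {`h52`, `hPT` ∀K, `hF1`, `h372`, `hGZK`, `hKo`, `hmod`}. [cite: Jetchev2008, Cor. 1.5 (p. 812)]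
[cite: Elkies2006, mod-9 lifting criterion] [cite: DiamondShurman2005, Thm. 8.8.1] -/
theorem bsdp_of_carrierAddCertificate_level_three_of_frobenius_of_literature
    (h52 : McCallum1991.prop52_exists_conductor_kolyvaginClass_order_eq)
    (hPT : ∀ (K : Type) [Field K] [NumberField K], poitouTate_selmerStructure_duality_conj K)
    (hF1 : Gross1991_heegnerPoint_sub_ratTorsion_mem_E0)
    (h372 : GrossLMS1991.prop37_2_frobeniusCongruence)
    (hGZK : rank_eq_analyticRank_of_analyticRank_le_one)
    (hKo : ∀ (N : ℕ) [NeZero N] (W : WeierstrassCurve ℚ) (K : Type) [Field K] [NumberField K],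
      kolyvagin N W K)
    (hmod : exists_isNewformOf)
    (W : WeierstrassCurve ℚ) [W.IsElliptic] [W.IsGloballyMinimal]
    {N : ℕ} [NeZero N] {K : Type} [Field K] [NumberField K] (hK : IsImaginaryQuadratic K)
    (hD3 : NumberField.discr K ≠ -3) (hD4 : NumberField.discr K ≠ -4)
    (hH : SatisfiesHeegnerHypothesis N K) {P : (W.baseChange K).toAffine.Point}
    (hP : IsHeegnerPoint N W K P) (hnt : ¬ IsOfFinAddOrder P)
    (hng : ¬ W.HasGoodReductionAtPrime 3) (hnm : ¬ W.HasMultiplicativeReductionAtPrime 3)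
    (hsurj : W.HasSurjectiveModNGaloisRep 3)
    (ℓ : ℕ) [Fact ℓ.Prime] (hgood : W.HasGoodReductionAtPrime ℓ) (hℓ9 : ℓ % 9 = 2 ∨ ℓ % 9 = 5)
    (ha9 : W.frobeniusTrace ℓ % 9 = 3 ∨ W.frobeniusTrace ℓ % 9 = 6)
    (hI : padicValNat 3 (AddSubgroup.zmultiples P).index ≤
      padicValNat 3 ((W.baseChange ℚ_[3]).localTamagawaNumber ℤ_[3]))
    (hr : W.analyticRank ≤ 1) {s : ℚ} (hs : shaAn W = (s : ℂ)) (hv : padicValRat 3 s = 0) :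
    BSDp W 3 :=
  bsdp_of_carrierAddCertificate_level_of_literature h52 hPT hF1 h372 hGZK hKo hmod W 3 hK hD3 hD4 hH hP hnt
    (by norm_num) hng hnm (W.forall_hasSurjectiveModNGaloisRep_three_pow_of_frobenius hsurj ℓ hgood hℓ9 ha9)
    hI hr hs hv

end Summit.BirchSwinnertonDyer.Rank1Residual.JET

end
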